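import Literature.NumberTheory.EllipticCurves.FunctionFieldPlacesGenusProofs
import Literature.NumberTheory.DiophantineGeometry.FunctionFieldHasseWeilProofs
import HarnessLib

/-!
# Weil's theorem "a global function field has a unique counting genus": the discharge

Topic `NumberTheory/EllipticCurves`; a theorems-only assembly file (no definitions, no new named
facts). The named fact `FunctionField.existsUnique_isGenus_of_functionField Fq F` of
`FunctionFieldPlacesGenusProofs` — for a global function field `F / 𝔽_q(T)` whose full constant
field is `𝔽_q` there is a unique `g : ℕ` with `IsGenus Fq F g`, i.e. `2g` complex numbers `α_i` of
absolute value `√q` with `N_n = qⁿ + 1 - ∑ α_iⁿ` for all `n ≥ 1` (Weil 1948; Rosen, Thms. 5.9, 5.10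
and the proof of Thm. 5.12; Stichtenoth, Thm. 5.1.15, Cor. 5.1.16, Thm. 5.2.1) — was reduced IN
THE TREE (`existsUnique_isGenus_of_functionField_of_isGenus_genus`, same file) to the bridge fact
`AlgFunctionField.isGenus_genus Fq F` of `FunctionFieldGenus` ("the genus read off from the zeta
function is the Riemann–Roch genus"), which has SINCE been proved
(`AlgFunctionField.isGenus_genus_holds`, `FunctionFieldHasseWeilProofs`: F. K. Schmidt's rationality
theorem and the Hasse–Weil theorem `hasseWeil_holds`). This file feeds the one to the other; the
`𝔽_q`-algebra structure on `F` that the bridge fact speaks about is the composite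
`𝔽_q → 𝔽_q[X] → F` of the fact's own instance stack (the device of
`AlgFunctionField.existsUnique_isGenus_of_lSeries_eq_polynomial_of_hasseWeil`,
`FunctionFieldZetaLPolynomialProofs`), so the discharge carries exactly the fact's own binders.

* `FunctionField.existsUnique_isGenus_of_functionField_holds Fq F` — the closed discharge.
* `FunctionField.existsUnique_isGenus_of_functionField'` — the same conclusion in the old spelling
  `existsUnique_isGenus Fq F` (definitionally equal at a global function field,
  `existsUnique_isGenus_of_functionField_iff`), the form the consumers in
  `FunctionFieldEllipticLRationality` / `FunctionFieldEllipticLConstantProofs` quantify over.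

## References

* A. Weil, *Sur les courbes algébriques et les variétés qui s'en déduisent* (1948). [`Weil1948`]
* M. Rosen, *Number Theory in Function Fields*, GTM 210 (2002), Thms. 5.9, 5.10, 5.12.
  [`RosenFunctionFields2002`]
* H. Stichtenoth, *Algebraic Function Fields and Codes*, 2nd ed., GTM 254 (2009), Thm. 5.1.15,
  Cor. 5.1.16, Thm. 5.2.1. [`Stichtenoth2009`]
-/

noncomputable section

open Polynomial

namespace Literature.NumberTheory.EllipticCurves.FunctionField

variable (Fq F : Type) [Field Fq] [Fintype Fq] [Field F]
  [Algebra Fq[X] F] [Algebra (RatFunc Fq) F] [IsScalarTower Fq[X] (RatFunc Fq) F]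
  [_root_.FunctionField Fq F]

/-- **Weil 1948: a global function field `F / 𝔽_q(T)` with full constant field `𝔽_q` has a unique
counting genus** (`∃! g, IsGenus Fq F g`; Rosen, Thms. 5.9, 5.10 and proof of Thm. 5.12;
Stichtenoth, Thm. 5.1.15, Cor. 5.1.16, Thm. 5.2.1). Discharge of the named fact
`existsUnique_isGenus_of_functionField Fq F` of `FunctionFieldPlacesGenusProofs`: the tree's
reduction to the Riemann–Roch genus (`existsUnique_isGenus_of_functionField_of_isGenus_genus`) fed
with the tree's theorem `AlgFunctionField.isGenus_genus_holds` (`FunctionFieldHasseWeilProofs`),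
for the composite `𝔽_q`-algebra structure `𝔽_q → 𝔽_q[X] → F`. [cite: Weil1948]
[cite: Stichtenoth2009, Thm. 5.1.15, Cor. 5.1.16, Thm. 5.2.1]
[cite: RosenFunctionFields2002, Thms. 5.9, 5.10 and proof of Thm. 5.12] -/
theorem existsUnique_isGenus_of_functionField_holds :
    existsUnique_isGenus_of_functionField Fq F := by
  letI : Algebra Fq F := ((algebraMap Fq[X] F).comp Polynomial.C).toAlgebra
  haveI : IsScalarTower Fq Fq[X] F := IsScalarTower.of_algebraMap_eq fun _ => rfl
  exact existsUnique_isGenus_of_functionField_of_isGenus_genus Fq F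
    DiophantineGeometry.AlgFunctionField.isGenus_genus_holds

/-- **Weil's theorem at a global function field, old spelling** (`existsUnique_isGenus Fq F`, the
hypothesis `hWeil` of the consumers in `FunctionFieldEllipticLRationality` /
`FunctionFieldEllipticLConstantProofs`): definitionally the discharge above
(`existsUnique_isGenus_of_functionField_iff`). [cite: Weil1948] -/
theorem existsUnique_isGenus_of_functionField' : existsUnique_isGenus Fq F :=
  (existsUnique_isGenus_of_functionField_iff Fq F).1
    (existsUnique_isGenus_of_functionField_holds Fq F)

end Literature.NumberTheory.EllipticCurves.FunctionField

end
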